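import Summits.ValiantsHypothesis.ValiantsHypothesis.Theorems.BarrierLeverUniversalCertificateCapacityBarrier
import Summits.ValiantsHypothesis.ValiantsHypothesis.Theorems.BarrierLeverTransversalSufficesForPrincipal

/-!
# Route BarrierLever — item `PartitionMinorsHitByVP` (stmt-ValiantsHypothesis-19717):
# the transversal-minor (bi-affine determinantal) template is NOT universal — located negative

Helper file (`--supports stmt-ValiantsHypothesis-19717`; cell valiant-natproofs, rung V4, 𝒟-side door
(c); prover seat val-np-p6 gen 7). Definition-free. Closes NO item.

The door `…PartitionMinorsHitByVPTransversalMinorDoor` (this seat) hits a layout `(u, w)` by the bi-affine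
determinant `f_A = det[Σ_{s,t} A (i,s) (j,t) x_i^s y_j^t]` as soon as some table
`A : Fin h × Bool → Fin h × Bool → ℂ` has `det[ det[A (i,[i ∈ u k]) (j,[j ∈ w l])]_{i,j} ]_{k,l} ≠ 0`, and
states item 19717 modulo «conjecture TM»: eventually in `h`, EVERY injective layout has such a table.

**`not_transversalMinors_eventually`: conjecture TM is FALSE.** The table of transversal minors of `A` is —
after re-indexing `Fin h × Bool ≃ Fin (h+h)` (rows: `(a, true) ↦ castAdd a`, `(a, false) ↦ natAdd a`;
columns: `(c, true) ↦ natAdd c`, `(c, false) ↦ castAdd c`) — exactly the layout matrix of the refuted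
conjecture TT (`Theses.BarrierLever.TransversalMinorLayoutsNonsingular`, item 19152), so the cell's kernel
chain applies verbatim: TT-matrix nonsingular ⇒ a principal-minor layout matrix is nonsingular
(`TransversalDictionary.exists_principal_layout_ne_zero`, item 19153) — impossible on the CAPACITY layout
(`CapacityBarrier.principalMinor_dead_layout`, val-np-p3 g4: rows `∅` + singletons, columns = the `32`
subsets of a `5`-block, singular for EVERY table once `h ≥ 31`; numerically the bi-affine template already
dies at `h = 15`, `r = 16`: rows `B₁([15])`, columns `2^{[4]}`).

So the transversal-minor door is a per-layout tool (census: one random table hits every layout at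
`h ≤ 3`, every lower-set pair at `h ≤ 5`, kit j291780), not a universal witness: it is subject to the
universal-certificate capacity barrier like TNS / TT (order-`1` jets on a block `T` span `≤ 1 + |T|²`
directions). WHAT THIS IS NOT: nothing on item 19717 itself (layout-dependent witnesses), on crux
stmt-ValiantsHypothesis-14610 or on `VP ≠ VNP`.
-/

set_option linter.dupNamespace false

namespace Summit.ValiantsHypothesis.ValiantsHypothesis.Theorems.BarrierLever.TransversalMinor

open Finset

/-- Re-indexing: the transversal-minor inner matrix `[A (a,[a ∈ U]) (c,[c ∈ W])]_{a,c}` is the TT-layout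
submatrix of the `(h+h) × (h+h)` matrix `H p q = A (rdec p) (cdec q)`. -/
theorem submatrix_reindex_eq {h : ℕ} (A : Fin h × Bool → Fin h × Bool → ℂ) (U W : Finset (Fin h)) :
    (Matrix.of fun p q : Fin (h + h) =>
        A (Fin.addCases (fun a => (a, true)) (fun a => (a, false)) p)
          (Fin.addCases (fun c => (c, false)) (fun c => (c, true)) q)).submatrix
      (fun a : Fin h => if a ∈ U then Fin.castAdd h a else Fin.natAdd h a)
      (fun c : Fin h => if c ∈ W then Fin.natAdd h c else Fin.castAdd h c) =
    Matrix.of fun a c : Fin h => A (a, decide (a ∈ U)) (c, decide (c ∈ W)) := by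
  ext a c
  simp only [Matrix.submatrix_apply, Matrix.of_apply]
  by_cases ha : a ∈ U <;> by_cases hc : c ∈ W <;>
    simp only [ha, hc, ↓reduceIte, Fin.addCases_left, Fin.addCases_right, decide_true, decide_false]

/-- **Conjecture TM is false**: there is no `h₀` beyond which every injective layout admits a table whose
layout determinant of transversal minors is nonzero (the hypothesis of
`TransversalMinor.partitionMinorsHitByVP_of_transversalMinors` is unsatisfiable). -/
theorem not_transversalMinors_eventually :
    ¬ ∃ h₀ : ℕ, ∀ h : ℕ, h₀ ≤ h → ∀ (r : ℕ) (u w : Fin r → Finset (Fin h)),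
      Function.Injective u → Function.Injective w →
        ∃ A : Fin h × Bool → Fin h × Bool → ℂ, (Matrix.of fun k l : Fin r =>
          (Matrix.of fun i j : Fin h => A (i, decide (i ∈ u k)) (j, decide (j ∈ w l))).det).det ≠ 0 := by
  rintro ⟨h₀, H⟩
  -- work at `h = max h₀ 31`, with the 5-block `T = {0,…,4}`
  set h := max h₀ 31 with hh_def
  have hh₀ : h₀ ≤ h := le_max_left _ _
  have h31 : 31 ≤ h := le_max_right _ _
  have h5 : 5 ≤ h := le_trans (by norm_num) h31
  set T : Finset (Fin h) := (Finset.univ : Finset (Fin 5)).map (Fin.castLEEmb h5) with hT_def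
  have hTcard : T.card = 5 := by simp [hT_def]
  have hT : T.card * T.card + 1 < 2 ^ T.card := by rw [hTcard]; norm_num
  have hhT : 2 ^ T.card ≤ h + 1 := by rw [hTcard]; omega
  obtain ⟨u, w, hu, hw, -, -, hdead⟩ := CapacityBarrier.principalMinor_dead_layout T hT hhT
  obtain ⟨A, hA⟩ := H h hh₀ _ u w hu hw
  -- the TT-layout matrix of the re-indexed table is the transversal-minor layout matrix
  have hTT : ∃ H' : Matrix (Fin (h + h)) (Fin (h + h)) ℂ, (Matrix.of fun i j : Fin (2 ^ T.card) =>
      (H'.submatrix (fun a : Fin h => if a ∈ u i then Fin.castAdd h a else Fin.natAdd h a)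
        (fun c : Fin h => if c ∈ w j then Fin.natAdd h c else Fin.castAdd h c)).det).det ≠ 0 := by
    refine ⟨Matrix.of fun p q : Fin (h + h) =>
        A (Fin.addCases (fun a => (a, true)) (fun a => (a, false)) p)
          (Fin.addCases (fun c => (c, false)) (fun c => (c, true)) q), ?_⟩
    have hmat : (Matrix.of fun i j : Fin (2 ^ T.card) =>
        ((Matrix.of fun p q : Fin (h + h) =>
          A (Fin.addCases (fun a => (a, true)) (fun a => (a, false)) p)
            (Fin.addCases (fun c => (c, false)) (fun c => (c, true)) q)).submatrix
          (fun a : Fin h => if a ∈ u i then Fin.castAdd h a else Fin.natAdd h a)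
          (fun c : Fin h => if c ∈ w j then Fin.natAdd h c else Fin.castAdd h c)).det) =
        Matrix.of fun k l : Fin (2 ^ T.card) =>
          (Matrix.of fun i j : Fin h => A (i, decide (i ∈ u k)) (j, decide (j ∈ w l))).det := by
      ext k l
      rw [Matrix.of_apply, Matrix.of_apply, submatrix_reindex_eq]
    rw [hmat]
    exact hA
  obtain ⟨K, hK⟩ := TransversalDictionary.exists_principal_layout_ne_zero u w hTT
  exact hK (hdead K)

end Summit.ValiantsHypothesis.ValiantsHypothesis.Theorems.BarrierLever.TransversalMinor
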